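import Mathlib
import Literature.Analysis.FluidPDE.TypeIAncientMild
import Literature.Analysis.FluidPDE.OseenDuhamelPairCalculus
import Literature.Analysis.FluidPDE.MildSolutionProofs
import Literature.Analysis.FluidPDE.LerayVolterraComparison
import Summits.NavierStokesRegularity.NavierStokesRegularity.Theorems.DssFarFieldSlavingBlowupTypeIDssProfileSimilarityEnstrophyTimeOnlyThreshold
import Summits.NavierStokesRegularity.NavierStokesRegularity.Theorems.SymmetryModuliCountSymmetricLiouvilleSmallAtMinusInfinity
import HarnessLib

/-!
# Census block A2 (amplitude meters), cells A2cb / A2bv (DECIDED), A2cl (reduced to the tree's Leray floor), A2cu / A2bu (OPEN) — instrument «COARSE METER», LINE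
# «coarse-meter» port, part 1/2: the one-window estimate (§A), the backward-end bootstrap (§B), the endgame (§C)

Re-homed for the scenario census (typer seat ns-census-typer-1 g8; cells of ns-idea-2 LINE g14-1 «coarse-meter», record-only ADDENDUM proposal 01:56:48Z, critic
idea-crit-3 g7 PASS — no price 02:09:02Z, ref PRE-CHECK asked by lead g10 RULING [9] (item 37); this port makes the decided cells TREE-decided): VERBATIM PORT of
`pub/ideators/ns-idea-2/lines/coarse-meter/line-coarse-meter.lean` sha16 9ac47ab9aa9477ee (558 l., lean check rc 0, 0 sorry), split for the 400-line rule into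
`ScenarioCensusCoarseMeter` (§A–§C) → `…CoarseMeterRows` (§D–§F + census KEYS).  Lean text VERBATIM in namespace `…Theorems.ScenarioCensus.CoarseMeter` (the line's
`…Lines.CoarseMeter` re-homed); port edits: `local notation "E3"` → `abbrev E3` (typer lint: no notation in port files), `@[conjecture]` on the OPEN rows `Row_A2cu` /
`Row_A2bu` (typed only).  `TreeLerayFloor` is the line's VERBATIM restatement (as a `Prop`, not re-proved) of the tree theorem `Theorems.stub_liminfFarPastLiouville`
(`Theorems/ClockStretchingLawClockCeilingLerayFloor.lean`), whose module the farm does not build at port time — `Row_A2cl` stays decided RELATIVE to it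
(`row_A2cl_of_treeLerayFloor`), exactly as filed.  Statements untouched.

No census VALUE is moved here (cells become TREE-decided by name; booking is the lead's); NS regularity is NOT proved; (L′) ⟨10661⟩ is untouched; no summit
statement is proved by this file.
-/

-- the summit and its single problem share the name `NavierStokesRegularity` (D-0017 nested layout)
set_option linter.dupNamespace false

noncomputable section

open Set Function Filter Topology Metric MeasureTheory

namespace Summit.NavierStokesRegularity.NavierStokesRegularity.Theorems.ScenarioCensus.CoarseMeter

open Literature.Analysis Literature.Analysis.FluidPDE
open Summit.NavierStokesRegularity.NavierStokesRegularity.Theorems.SimilarityEnstrophy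
  (typeI_ancient_eq_zero_of_rate_lt_one)
open Summit.NavierStokesRegularity.NavierStokesRegularity.Theorems.SymmetryModuliCountSymmetricLiouville
  (vanishes_of_vanishes_before)

/-- `ℝ³` (the line's `local notation "E3"`, spelled as a reducible abbreviation for the tree). -/
abbrev E3 := EuclideanSpace ℝ (Fin 3)

/-! ## A. The one-window estimate (the lever) -/

/-- Elementary facts about the relative scale `L ∈ (0, 1/2]`: `0 < 1 - L²`, and the contraction
factor `ρ = √(1 - L²)` satisfies `1/2 ≤ ρ ≤ 1`. -/
theorem scale_facts {L : ℝ} (hL0 : 0 < L) (hL : L ≤ 1 / 2) :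
    0 < 1 - L ^ 2 ∧ 1 / 2 ≤ Real.sqrt (1 - L ^ 2) ∧ Real.sqrt (1 - L ^ 2) ≤ 1 := by
  have hL2 : L ^ 2 ≤ 1 / 4 := by nlinarith
  refine ⟨by linarith, ?_, ?_⟩
  · rw [show (1 / 2 : ℝ) = Real.sqrt (1 / 4) by
      rw [show (1 / 4 : ℝ) = (1 / 2) ^ 2 by norm_num, Real.sqrt_sq (by norm_num)]]
    exact Real.sqrt_le_sqrt (by linarith)
  · calc Real.sqrt (1 - L ^ 2) ≤ Real.sqrt 1 := Real.sqrt_le_sqrt (by nlinarith)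
      _ = 1 := Real.sqrt_one

/-- **The memory-window estimate (the lever of the line).**  Let `u ∈ A_C`
(`IsTypeIAncientMild C u`), `t < 0`, `L ∈ (0, 1/2]`, and put `τ = (1 - L²) t ∈ (t, 0)`, so that
`τ - t = L² (-t)`.  The Oseen identity from `t` to `τ` reads
`u(τ) = e^{L²(-t)Δ} u(t) - B¹_t(u, u)(τ)`: the FREE part of `u(τ)` is the heat average of the slice
`u(t)` at the parabolic scale `L √(-t)` — the COARSE-GRAINED FIELD.  If that coarse-grained field is
`ε`-small in scale-invariant units, `√(-t) ‖e^{L²(-t)Δ}u(t)‖_∞ ≤ ε`, and `√(-τ)‖u‖ ≤ K` on the window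
`(t, τ) × ℝ³`, then `√(-τ) ‖u(τ, x)‖ ≤ ε + 4 C₀ L K²` (`C₀ = oseenSliceConst`): the window is so
short that the nonlinearity contributes only `2 C₀ √(τ - t) · K²/(-τ) = 2 C₀ L K² /√(1 - L²) · (-τ)^{-1/2}`. -/
theorem coarse_step {C : ℝ} {u : ℝ → E3 → E3} (h : IsTypeIAncientMild C u) {L t ε K : ℝ}
    (hL0 : 0 < L) (hL : L ≤ 1 / 2) (ht : t < 0) (hε : 0 ≤ ε) (hK : 0 ≤ K)
    (hcoarse : ∀ x, Real.sqrt (-t) * ‖heatFlow (u t) (L ^ 2 * (-t)) x‖ ≤ ε)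
    (hwin : ∀ σ ∈ Ioo t ((1 - L ^ 2) * t), ∀ y,
      Real.sqrt (-((1 - L ^ 2) * t)) * ‖u σ y‖ ≤ K) :
    ∀ x, Real.sqrt (-((1 - L ^ 2) * t)) * ‖u ((1 - L ^ 2) * t) x‖ ≤
      ε + 4 * oseenSliceConst E3 * L * K ^ 2 := by
  intro x
  have hC₀ : 0 < oseenSliceConst E3 := oseenSliceConst_pos
  obtain ⟨h1L, hρhalf, hρ1⟩ := scale_facts hL0 hL
  set ρ : ℝ := Real.sqrt (1 - L ^ 2) with hρ
  have hρ0 : 0 < ρ := lt_of_lt_of_le (by norm_num) hρhalf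
  have hρsq : ρ ^ 2 = 1 - L ^ 2 := by rw [hρ, Real.sq_sqrt h1L.le]
  set τ : ℝ := (1 - L ^ 2) * t with hτ
  have hτ0 : τ < 0 := mul_neg_of_pos_of_neg h1L ht
  have htτ : t < τ := by
    have : τ - t = L ^ 2 * (-t) := by rw [hτ]; ring
    nlinarith [pow_pos hL0 2]
  have hτt : τ - t = L ^ 2 * (-t) := by rw [hτ]; ring
  set s : ℝ := Real.sqrt (-t) with hs
  have hs0 : 0 < s := Real.sqrt_pos.2 (by linarith)
  have hssq : s ^ 2 = -t := by rw [hs, Real.sq_sqrt (by linarith)]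
  -- `√(-τ) = ρ s`
  have hsτ : Real.sqrt (-τ) = ρ * s := by
    rw [show -τ = (1 - L ^ 2) * (-t) by rw [hτ]; ring, Real.sqrt_mul h1L.le]
  have hsτ0 : 0 < Real.sqrt (-τ) := by rw [hsτ]; positivity
  -- the a-priori bound on the window, in plain units
  set P : ℝ := K / (ρ * s) with hP
  have hP0 : 0 ≤ P := by positivity
  have hwin' : ∀ σ ∈ Ioo t τ, ∀ y, ‖u σ y‖ ≤ P := by
    intro σ hσ y
    have := hwin σ hσ y
    rw [hsτ] at this
    rw [hP, le_div_iff₀ (by positivity)]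
    linarith [this]
  -- the free part
  have hfree : ‖heatFlow (u t) (τ - t) x‖ ≤ ε / s := by
    rw [hτt, le_div_iff₀ hs0]
    have := hcoarse x
    linarith [this]
  -- the Duhamel part
  have hint : IntegrableOn (fun σ => (τ - σ) ^ (-(1 / 2 : ℝ)) * (P * P)) (Ioo t τ) :=
    (integrableOn_sub_rpow_Ioo (by norm_num)).mul_const _
  have hduh := norm_oseenDuhamel_le_setIntegral (E := E3) (t₀ := t) (t := τ) (a := u) (b := u)
    (Ma := fun _ => P) (Mb := fun _ => P) hwin' hwin' hint x
  have hval : ∫ σ in Ioo t τ, (τ - σ) ^ (-(1 / 2 : ℝ)) * (P * P) = 2 * (L * s) * (P * P) := by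
    rw [integral_mul_const, setIntegral_Ioo_sub_rpow_neg_half htτ.le, ← Real.sqrt_eq_rpow, hτt,
      Real.sqrt_mul (sq_nonneg L), Real.sqrt_sq hL0.le]
  have hB : ‖oseenDuhamel 1 t u u τ x‖ ≤ oseenSliceConst E3 * (2 * (L * s) * (P * P)) := by
    rw [← hval]; exact hduh
  -- assemble in plain units
  have hu : ‖u τ x‖ ≤ ε / s + oseenSliceConst E3 * (2 * (L * s) * (P * P)) := by
    rw [h.mild_eq htτ hτ0 x]
    exact (norm_sub_le _ _).trans (add_le_add hfree hB)
  -- multiply by `√(-τ) = ρ s`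
  rw [hsτ]
  have hPs : P * (ρ * s) = K := by rw [hP]; field_simp
  calc ρ * s * ‖u τ x‖ ≤ ρ * s * (ε / s + oseenSliceConst E3 * (2 * (L * s) * (P * P))) :=
        mul_le_mul_of_nonneg_left hu (by positivity)
    _ = ρ * ε + (2 * oseenSliceConst E3 * L * K ^ 2) / ρ := by
        field_simp
        rw [← hPs]
        ring
    _ ≤ ε + 4 * oseenSliceConst E3 * L * K ^ 2 := by
        have h1 : ρ * ε ≤ ε := by nlinarith
        have h2 : (2 * oseenSliceConst E3 * L * K ^ 2) / ρ ≤ 4 * oseenSliceConst E3 * L * K ^ 2 := by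
          rw [div_le_iff₀ hρ0]
          have : 0 ≤ 2 * oseenSliceConst E3 * L * K ^ 2 := by positivity
          nlinarith
        linarith

/-! ## B. The backward-end bootstrap -/

/-- **Coarse-grained smallness on a backward end forces scale-invariant smallness there.**  If
`u ∈ A_C`, `L ∈ (0, 1/2]` with `8 C₀ L C ≤ 1`, and the coarse-grained field at relative scale `L` is
`ε`-small at every time `t ≤ T < 0`, then `√(-τ)‖u(τ, x)‖ ≤ 2ε` for all `τ ≤ (1 - L²) T`.
Bootstrap on `M = sup_{τ ≤ (1-L²)T} √(-τ)‖u(τ)‖_∞ ≤ C`: the window estimate gives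
`M ≤ ε + 4 C₀ L M² ≤ ε + 4 C₀ L C · M ≤ ε + M/2`. No continuity of the sup is used. -/
theorem coarse_backward_end {C : ℝ} {u : ℝ → E3 → E3} (h : IsTypeIAncientMild C u)
    {L T ε : ℝ} (hL0 : 0 < L) (hL : L ≤ 1 / 2)
    (hLC : 8 * oseenSliceConst E3 * L * C ≤ 1) (hT : T < 0) (hε : 0 ≤ ε)
    (hcoarse : ∀ t ≤ T, ∀ x, Real.sqrt (-t) * ‖heatFlow (u t) (L ^ 2 * (-t)) x‖ ≤ ε) :
    ∀ τ ≤ (1 - L ^ 2) * T, ∀ x, Real.sqrt (-τ) * ‖u τ x‖ ≤ 2 * ε := by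
  have hC : 0 ≤ C := h.nonneg
  have hC₀ : 0 < oseenSliceConst E3 := oseenSliceConst_pos
  obtain ⟨h1L, -, -⟩ := scale_facts hL0 hL
  set T' : ℝ := (1 - L ^ 2) * T with hT'
  have hT'0 : T' < 0 := mul_neg_of_pos_of_neg h1L hT
  -- the a-priori bound `√(-τ)‖u(τ, y)‖ ≤ C`
  have hbound : ∀ τ ≤ T', ∀ y, Real.sqrt (-τ) * ‖u τ y‖ ≤ C := by
    intro τ hτ y
    have hτ0 : τ < 0 := lt_of_le_of_lt hτ hT'0
    have hsq : 0 < Real.sqrt (-τ) := Real.sqrt_pos.2 (by linarith)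
    calc Real.sqrt (-τ) * ‖u τ y‖ ≤ Real.sqrt (-τ) * (C / Real.sqrt (-τ)) :=
          mul_le_mul_of_nonneg_left (h.norm_le hτ0 y) hsq.le
      _ = C := by field_simp
  -- the scale-invariant amplitude on the backward end
  set V : Set ℝ := (fun p : ℝ × E3 => Real.sqrt (-p.1) * ‖u p.1 p.2‖) '' (Iic T' ×ˢ univ) with hV
  have hVbdd : BddAbove V := by
    refine ⟨C, ?_⟩
    rintro r ⟨⟨τ, y⟩, ⟨hτ, -⟩, rfl⟩
    exact hbound τ hτ y
  have hVne : V.Nonempty :=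
    ⟨_, ⟨((T', (0 : E3)) : ℝ × E3), ⟨(le_rfl : T' ≤ T'), mem_univ _⟩, rfl⟩⟩
  set M : ℝ := sSup V with hM
  have hle : ∀ τ ≤ T', ∀ y, Real.sqrt (-τ) * ‖u τ y‖ ≤ M := fun τ hτ y =>
    le_csSup hVbdd ⟨((τ, y) : ℝ × E3), ⟨hτ, mem_univ _⟩, rfl⟩
  have hMC : M ≤ C := by
    refine csSup_le hVne ?_
    rintro r ⟨⟨τ, y⟩, ⟨hτ, -⟩, rfl⟩
    exact hbound τ hτ y
  have hM0 : 0 ≤ M :=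
    le_trans (mul_nonneg (Real.sqrt_nonneg _) (norm_nonneg _)) (hle T' le_rfl 0)
  -- key inequality `M ≤ ε + 4 C₀ L M²`
  have hkey : M ≤ ε + 4 * oseenSliceConst E3 * L * M ^ 2 := by
    refine csSup_le hVne ?_
    rintro r ⟨⟨τ, y⟩, ⟨hτ, -⟩, rfl⟩
    set t : ℝ := τ / (1 - L ^ 2) with ht
    have hτt : τ = (1 - L ^ 2) * t := by rw [ht]; field_simp
    have htT : t ≤ T := by
      rw [ht, div_le_iff₀ h1L]
      have : τ ≤ T' := hτ
      rw [hT'] at this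
      linarith
    have ht0 : t < 0 := lt_of_le_of_lt htT hT
    have hwin : ∀ σ ∈ Ioo t ((1 - L ^ 2) * t), ∀ z,
        Real.sqrt (-((1 - L ^ 2) * t)) * ‖u σ z‖ ≤ M := by
      intro σ hσ z
      rw [← hτt] at hσ ⊢
      have hσT : σ ≤ T' := hσ.2.le.trans hτ
      calc Real.sqrt (-τ) * ‖u σ z‖ ≤ Real.sqrt (-σ) * ‖u σ z‖ :=
            mul_le_mul_of_nonneg_right (Real.sqrt_le_sqrt (by linarith [hσ.2])) (norm_nonneg _)
        _ ≤ M := hle σ hσT z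
    have step := coarse_step h hL0 hL ht0 hε hM0 (hcoarse t htT) hwin y
    change Real.sqrt (-τ) * ‖u τ y‖ ≤ ε + 4 * oseenSliceConst E3 * L * M ^ 2
    rw [hτt]
    exact step
  -- absorb the quadratic term: `4 C₀ L M² ≤ M/2`
  have habs : 4 * oseenSliceConst E3 * L * M ^ 2 ≤ M / 2 := by
    have h1 : 4 * oseenSliceConst E3 * L * M ≤ 4 * oseenSliceConst E3 * L * C :=
      mul_le_mul_of_nonneg_left hMC (by positivity)
    have h2 : 4 * oseenSliceConst E3 * L * M ≤ 1 / 2 := by linarith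
    calc 4 * oseenSliceConst E3 * L * M ^ 2 = (4 * oseenSliceConst E3 * L * M) * M := by ring
      _ ≤ (1 / 2) * M := mul_le_mul_of_nonneg_right h2 hM0
      _ = M / 2 := by ring
  have hM2 : M ≤ 2 * ε := by linarith
  intro τ hτ x
  exact (hle τ hτ x).trans hM2

/-! ## C. The endgame (tree theorems only) -/

/-- **Endgame.**  Scale-invariant smallness `√(-τ)‖u(τ, x)‖ ≤ m < 1` on a backward end `τ ≤ T`
forces `u ≡ 0`: the backward shift `t ↦ u(t + T)` lies in the class with constant `m`
(`IsTypeIAncientMild.comp_sub_right` + the improved decay), the tree's time-only threshold theorem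
`typeI_ancient_eq_zero_of_rate_lt_one` (route DssFarFieldSlaving, census A2a: constant `< 1` ⇒ zero)
kills it, and forward uniqueness `vanishes_of_vanishes_before` (route SymmetryModuliCount) carries the
vanishing up to `t < 0`. -/
theorem eq_zero_of_small_backward_end {C : ℝ} {u : ℝ → E3 → E3} (h : IsTypeIAncientMild C u)
    {T m : ℝ} (hT : T < 0) (hm : m < 1)
    (hsmall : ∀ τ ≤ T, ∀ x, Real.sqrt (-τ) * ‖u τ x‖ ≤ m) : ∀ t < 0, ∀ x, u t x = 0 := by
  have hv : IsTypeIAncientMild C (fun t => u (t - (-T))) := h.comp_sub_right (by linarith)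
  have hv' : IsTypeIAncientMild m (fun t => u (t - (-T))) := by
    refine ⟨hv.1, hv.2.1, hv.2.2.1, fun t ht x => ?_⟩
    have hτ : t - (-T) ≤ T := by linarith
    have hs0 : 0 < Real.sqrt (-t) := Real.sqrt_pos.2 (by linarith)
    have hst : Real.sqrt (-t) ≤ Real.sqrt (-(t - (-T))) := Real.sqrt_le_sqrt (by linarith)
    have key := hsmall _ hτ x
    rw [le_div_iff₀ hs0]
    calc ‖u (t - -T) x‖ * Real.sqrt (-t) ≤ ‖u (t - -T) x‖ * Real.sqrt (-(t - (-T))) :=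
          mul_le_mul_of_nonneg_left hst (norm_nonneg _)
      _ ≤ m := by rw [mul_comm]; exact key
  have hz := typeI_ancient_eq_zero_of_rate_lt_one hv' hm
  refine vanishes_of_vanishes_before h hT (fun t ht x => ?_)
  have := hz (t - T) (by linarith) x
  simpa using this

end Summit.NavierStokesRegularity.NavierStokesRegularity.Theorems.ScenarioCensus.CoarseMeter

end
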